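import Summits.CriticalPhenomena.PercolationContinuityZ3.Theorems.PercNearOneGluingNoHeavyLowerTailChampionStability
import Summits.CriticalPhenomena.PercolationContinuityZ3.Theorems.PercNearOneGluingAdditiveGluingOneBond
import Literature.Probability.LatticeModels.ProdBernoulliIndependence
import HarnessLib

/-!
# `NoHeavyLowerTail` (stmt-CriticalPhenomena-4575) — two-port peeling: the θ-champion dominates the virtual relay `(a | a b̄)`

Route `PercNearOneGluingNoHeavy`, seat `prim-gen-swap` (gen 5); seat memo TWO-PORT-PEELING.md §2, §5 (P1).  `μ_w = prodBernoulli w` on `Fin n`,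
relays `A`, level `j`, `π(z) = {x ∈ A : z ↔ x}`, `R_z = {|π(z)| ≤ j}`.  For relays `a, b, b', c` (pairwise distinct) write `w⁺ = w[s(b,b')↦1]`
(`b, b'` glued) and `w⁺⁺ = w⁺[s(a,b)↦1]` (`a` glued into the pair).

* `TwoPortPeeling.drop_subset` — POINTWISE: if `s(b,b')` is open in `ω`, `|π_ω(c)| ≤ j` and gluing `a` to `b` makes `c`'s block big, then
  `a`'s block is small in `ω` and big after the gluing — provided `j ≤ 2` or `|A| ≤ j + 3` (the only obstruction is a block
  `{c,b,b',…}` of size `≤ j` next to a block of `a` of size `≥ j+1`, which needs `j ≥ 3` and `|A| ≥ j + 4`);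
* `TwoPortPeeling.glue_margin_mono` — hence gluing `a` into the glued pair does not decrease `c`'s margin over `a`:
  `μ_{w⁺}(R_c) − μ_{w⁺}(R_a) ≤ μ_{w⁺⁺}(R_c) − μ_{w⁺⁺}(R_a)`;
* `thetaChampion_virtualRelay` — (E_rel of the memo) if `c` θ-beats `a`, `(1−θ)(μ_w(R_c) − μ_w(R_a)) + θ(μ_{w⁺}(R_c) − μ_{w⁺}(R_a)) ≥ 0`
  (the champion row of `c` against `a` in the graph `w + θ·e_{bb'}`), then also
  `(1−θ)(μ_w(R_c) − μ_w(R_a)) + θ(μ_{w⁺⁺}(R_c) − μ_{w⁺⁺}(R_a)) ≥ 0` — the row against the "virtual relay" that is `a` when the pair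
  is not glued and `a b̄` when it is.  This is one of the two bookkeeping inputs of the proof of MS-STAR for two two-port stars (memo §5);
  it is law-free (true for every law on partitions) exactly in the range `j ≤ 2 ∨ |A| ≤ j+3`, which contains the rung `(|A|,j) = (5,2)`.
Appended (same seat): `drop_subset_of_reachable`, `glue_margin_mono_of_ae_reachable`, `thetaChampion_virtualRelay_of_ae_reachable` — the same
three statements with the open pair `s(b,b')` replaced by "`b ↔ b'` almost surely" (any realisation of the glued pair, e.g. a star glued to both).
No definitions, no named facts, no sorries.
-/

noncomputable section

namespace Summit.CriticalPhenomena.PercolationContinuityZ3.Theorems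

open MeasureTheory Set Literature.Probability.LatticeModels Literature.Probability.Percolation
open scoped Classical BigOperators

variable {n : ℕ}

namespace TwoPortPeeling

/-- Opening a pair only adds connections. [folklore] -/
theorem reachable_insert_of_reachable (ω : BondConfig (Fin n)) (e : Sym2 (Fin n)) {x y : Fin n}
    (h : (openGraph ω).Reachable x y) : (openGraph (insert e ω)).Reachable x y := by
  refine h.mono fun u v huv => ?_
  rw [openGraph_adj] at huv ⊢
  exact ⟨Set.mem_insert_of_mem _ huv.1, huv.2⟩

/-- Opening a pair can only shrink a loneliness event `{|π(x)| ≤ j}`. [folklore] -/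
theorem lonely_of_lonely_insert (A : Finset (Fin n)) (ω : BondConfig (Fin n)) (e : Sym2 (Fin n)) (x : Fin n) (j : ℕ)
    (h : (A.filter fun z => insert e ω ∈ openConn x z).card ≤ j) :
    (A.filter fun z => ω ∈ openConn x z).card ≤ j := by
  refine le_trans (Finset.card_le_card fun z hz => ?_) h
  rw [Finset.mem_filter] at hz ⊢
  exact ⟨hz.1, reachable_insert_of_reachable ω e hz.2⟩

/-- Two joined vertices have the same relay set. [folklore] -/
theorem filter_eq_of_reachable (A : Finset (Fin n)) (ω : BondConfig (Fin n)) {x y : Fin n}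
    (h : (openGraph ω).Reachable x y) :
    (A.filter fun z => ω ∈ openConn x z) = (A.filter fun z => ω ∈ openConn y z) :=
  Finset.filter_congr fun _ _ => ⟨fun hz => h.symm.trans hz, fun hz => h.trans hz⟩

/-- **Pointwise drop inclusion (P1 of the memo).**  Relays `a, b, b', c` pairwise distinct in `A`, `s(b,b')` open in `ω`, and
`j ≤ 2 ∨ |A| ≤ j + 3`.  If `|π_ω(c)| ≤ j` but `|π_{ω ∪ {s(a,b)}}(c)| > j`, then `|π_ω(a)| ≤ j` and `|π_{ω ∪ {s(a,b)}}(a)| > j`. [this file] -/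
theorem drop_subset (A : Finset (Fin n)) (ω : BondConfig (Fin n)) (a b b' c : Fin n) (j : ℕ)
    (hb : b ∈ A) (hb' : b' ∈ A) (hc : c ∈ A)
    (hab : a ≠ b) (hbb' : b ≠ b') (hca : c ≠ a) (hcb : c ≠ b) (hcb' : c ≠ b')
    (hreg : j ≤ 2 ∨ A.card ≤ j + 3) (hopen : s(b, b') ∈ ω)
    (hc_small : (A.filter fun z => ω ∈ openConn c z).card ≤ j)
    (hc_big : ¬ (A.filter fun z => insert s(a, b) ω ∈ openConn c z).card ≤ j) :
    (A.filter fun z => ω ∈ openConn a z).card ≤ j ∧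
      ¬ (A.filter fun z => insert s(a, b) ω ∈ openConn a z).card ≤ j := by
  -- `c` must be joined to `a` or to `b` in `ω`, otherwise its cluster does not change
  have hbb : (openGraph ω).Reachable b b' := by
    refine SimpleGraph.Adj.reachable ?_
    rw [openGraph_adj]
    exact ⟨hopen, hbb'⟩
  by_cases hca' : (openGraph ω).Reachable c a
  · -- same block as `a`, before and after
    refine ⟨?_, ?_⟩
    · rw [← filter_eq_of_reachable A ω hca']; exact hc_small
    · rw [← filter_eq_of_reachable A (insert s(a, b) ω) (reachable_insert_of_reachable ω _ hca')]; exact hc_big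
  by_cases hcb'' : (openGraph ω).Reachable c b
  · -- `c ~ b ~ b'`: the block of `c` has at least three relays, so `j ≥ 3`, and `a`'s block has at most `|A| - 3 ≤ j` relays
    have h3 : 3 ≤ (A.filter fun z => ω ∈ openConn c z).card := by
      have hsub : ({c, b, b'} : Finset (Fin n)) ⊆ A.filter fun z => ω ∈ openConn c z := by
        intro z hz
        simp only [Finset.mem_insert, Finset.mem_singleton] at hz
        rw [Finset.mem_filter]
        rcases hz with rfl | rfl | rfl
        · exact ⟨hc, (SimpleGraph.Reachable.refl _ : (openGraph ω).Reachable _ _)⟩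
        · exact ⟨hb, hcb''⟩
        · exact ⟨hb', hcb''.trans hbb⟩
      have hcard : ({c, b, b'} : Finset (Fin n)).card = 3 := by
        rw [Finset.card_eq_three]
        exact ⟨c, b, b', hcb, hcb', hbb', rfl⟩
      exact hcard ▸ Finset.card_le_card hsub
    rcases hreg with hj | hk
    · exact absurd (h3.trans hc_small) (by omega)
    · -- disjoint blocks of `a` and `c`
      have hdisj : Disjoint (A.filter fun z => ω ∈ openConn a z) (A.filter fun z => ω ∈ openConn c z) := by
        rw [Finset.disjoint_left]
        intro z hza hzc
        rw [Finset.mem_filter] at hza hzc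
        exact hca' ((hzc.2 : (openGraph ω).Reachable c z).trans (hza.2 : (openGraph ω).Reachable a z).symm)
      have hsum : (A.filter fun z => ω ∈ openConn a z).card + (A.filter fun z => ω ∈ openConn c z).card ≤ A.card := by
        rw [← Finset.card_union_of_disjoint hdisj]
        exact Finset.card_le_card (Finset.union_subset (Finset.filter_subset _ _) (Finset.filter_subset _ _))
      refine ⟨by omega, ?_⟩
      -- after gluing, `a ~ b ~ c`, so `a`'s block is `c`'s block, which is big
      have hac' : (openGraph (insert s(a, b) ω)).Reachable a c := by
        have hab' : (openGraph (insert s(a, b) ω)).Reachable a b := by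
          refine SimpleGraph.Adj.reachable ?_
          rw [openGraph_adj]
          exact ⟨Set.mem_insert _ _, hab⟩
        exact hab'.trans (reachable_insert_of_reachable ω _ hcb''.symm)
      rw [filter_eq_of_reachable A (insert s(a, b) ω) hac']
      exact hc_big
  · -- `c` joined to neither `a` nor `b`: its block is unchanged, contradiction
    exfalso
    apply hc_big
    have heq : (A.filter fun z => insert s(a, b) ω ∈ openConn c z) = (A.filter fun z => ω ∈ openConn c z) :=
      Finset.filter_congr fun z _ => ChampionStability.reachable_insert_iff_of_not ω hab hca' hcb'' z
    rw [heq]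
    exact hc_small

/-- **Gluing `a` into the glued pair does not decrease `c`'s margin over `a`** (quantitative observer-set comparison in the range
`j ≤ 2 ∨ |A| ≤ j+3`):  with `w⁺ = w[s(b,b')↦1]`, `w⁺⁺ = w⁺[s(a,b)↦1]`,
`μ_{w⁺}(R_c) − μ_{w⁺}(R_a) ≤ μ_{w⁺⁺}(R_c) − μ_{w⁺⁺}(R_a)`.  Proof: one-bond decomposition at `s(a,b)`, pull-back along
`ω ↦ ω ∪ {s(a,b)}`, and `drop_subset` off the null set `{s(b,b') closed}`. [this file] -/
theorem glue_margin_mono (w : Sym2 (Fin n) → unitInterval) (A : Finset (Fin n)) (a b b' c : Fin n) (j : ℕ)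
    (hb : b ∈ A) (hb' : b' ∈ A) (hc : c ∈ A)
    (hab : a ≠ b) (hab' : a ≠ b') (hbb' : b ≠ b') (hca : c ≠ a) (hcb : c ≠ b) (hcb' : c ≠ b')
    (hreg : j ≤ 2 ∨ A.card ≤ j + 3) :
    (prodBernoulli (Function.update w s(b, b') 1)).real {ω : BondConfig (Fin n) | (A.filter fun z => ω ∈ openConn c z).card ≤ j} -
        (prodBernoulli (Function.update w s(b, b') 1)).real {ω : BondConfig (Fin n) | (A.filter fun z => ω ∈ openConn a z).card ≤ j} ≤
      (prodBernoulli (Function.update (Function.update w s(b, b') 1) s(a, b) 1)).real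
          {ω : BondConfig (Fin n) | (A.filter fun z => ω ∈ openConn c z).card ≤ j} -
        (prodBernoulli (Function.update (Function.update w s(b, b') 1) s(a, b) 1)).real
          {ω : BondConfig (Fin n) | (A.filter fun z => ω ∈ openConn a z).card ≤ j} := by
  have hee : (s(a, b) : Sym2 (Fin n)) ≠ s(b, b') := by
    intro h
    rw [Sym2.eq_iff] at h
    rcases h with ⟨h, -⟩ | ⟨h, -⟩
    · exact hab h
    · exact hab' h
  set w1 := Function.update w s(b, b') 1 with hw1
  set w10 := Function.update w1 s(a, b) 0 with hw10
  set R : Fin n → Set (BondConfig (Fin n)) := fun x => {ω | (A.filter fun z => ω ∈ openConn x z).card ≤ j} with hR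
  set ins : BondConfig (Fin n) → BondConfig (Fin n) := fun ω => insert s(a, b) ω with hins
  have hmeas : ∀ S : Set (BondConfig (Fin n)), MeasurableSet S := fun _ => MeasurableSet.of_discrete
  -- the glued law is the pull-back of `μ_{w10}`; the unglued law is a mixture of `μ_{w10}` and the glued law
  have h11 : Function.update w1 s(a, b) 1 = Function.update w10 s(a, b) 1 := by rw [hw10, Function.update_idem]
  have h10e : w10 s(a, b) = 0 := by rw [hw10, Function.update_self]
  have hpull : ∀ S : Set (BondConfig (Fin n)),
      (prodBernoulli (Function.update w1 s(a, b) 1)).real S = (prodBernoulli w10).real (ins ⁻¹' S) := by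
    intro S; rw [h11]; exact ChampionStability.real_update_one_eq w10 h10e S
  have hmix : ∀ S : Set (BondConfig (Fin n)), (prodBernoulli w1).real S =
      (1 - (w1 s(a, b) : ℝ)) * (prodBernoulli w10).real S + (w1 s(a, b) : ℝ) * (prodBernoulli w10).real (ins ⁻¹' S) := by
    intro S; rw [stub_oneBondDecomp_k15 n w1 s(a, b) S, ← hw10, hpull S]
  -- monotonicity: `ins ⁻¹' R_x ⊆ R_x`
  have hsub : ∀ x : Fin n, ins ⁻¹' R x ⊆ R x := fun x ω hω => lonely_of_lonely_insert A ω s(a, b) x j hω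
  have hdiff : ∀ x : Fin n, (prodBernoulli w10).real (R x) - (prodBernoulli w10).real (ins ⁻¹' R x) =
      (prodBernoulli w10).real (R x \ ins ⁻¹' R x) := fun x =>
    (measureReal_sdiff (hsub x) (hmeas _)).symm
  -- the null set `{s(b,b') closed}` under `w10` (weight 1 there)
  set Z : Set (BondConfig (Fin n)) := {ω | s(b, b') ∉ ω} with hZ
  have hZ0 : (prodBernoulli w10).real Z = 0 := by
    have h1 : (w10 s(b, b') : ℝ) = 1 := by
      rw [hw10, Function.update_of_ne hee.symm, hw1, Function.update_self]; rfl
    rw [hZ, prodBernoulli_real_setOf_notMem w10 s(b, b'), h1, sub_self]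
  -- the drop inclusion off `Z`
  have hincl : R c \ ins ⁻¹' R c ⊆ (R a \ ins ⁻¹' R a) ∪ Z := by
    intro ω hω
    by_cases hωZ : ω ∈ Z
    · exact Or.inr hωZ
    · have hopen : s(b, b') ∈ ω := by
        by_contra h; exact hωZ h
      obtain ⟨h1, h2⟩ := drop_subset A ω a b b' c j hb hb' hc hab hbb' hca hcb hcb' hreg hopen hω.1 hω.2
      exact Or.inl ⟨h1, h2⟩
  have hkey : (prodBernoulli w10).real (R c \ ins ⁻¹' R c) ≤ (prodBernoulli w10).real (R a \ ins ⁻¹' R a) := by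
    refine (measureReal_mono hincl).trans ((measureReal_union_le _ _).trans ?_)
    rw [hZ0, add_zero]
  -- assemble
  have hp0 : 0 ≤ 1 - (w1 s(a, b) : ℝ) := sub_nonneg.2 (w1 s(a, b)).2.2
  rw [hmix (R c), hmix (R a), hpull (R c), hpull (R a)]
  rw [← hdiff c, ← hdiff a] at hkey
  nlinarith [hkey, hp0]

end TwoPortPeeling

open TwoPortPeeling in
/-- **The θ-champion dominates the virtual relay `(a | a b̄)` (E_rel of the memo).**  For bond percolation with arbitrary edge
probabilities on `Fin n`, relays `A`, a level `j` with `j ≤ 2 ∨ |A| ≤ j + 3`, pairwise distinct relays `a, b, b', c ∈ A` and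
`θ ∈ [0,1]`: if `(1−θ)(μ_w(R_c) − μ_w(R_a)) + θ(μ_{w⁺}(R_c) − μ_{w⁺}(R_a)) ≥ 0` (`c` beats `a` in the graph `w + θ·e_{bb'}`, `w⁺ = w[s(b,b')↦1]`),
then `(1−θ)(μ_w(R_c) − μ_w(R_a)) + θ(μ_{w⁺⁺}(R_c) − μ_{w⁺⁺}(R_a)) ≥ 0` with `w⁺⁺ = w⁺[s(a,b)↦1]` (`a` glued into the pair).  Law-free in
this range and false as a law-free statement from `(|A|,j) = (7,3)` on (memo §2).  [this file; `glue_margin_mono`] -/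
theorem thetaChampion_virtualRelay (w : Sym2 (Fin n) → unitInterval) (A : Finset (Fin n)) (a b b' c : Fin n) (j : ℕ)
    (θ : ℝ) (hθ0 : 0 ≤ θ)
    (hb : b ∈ A) (hb' : b' ∈ A) (hc : c ∈ A)
    (hab : a ≠ b) (hab' : a ≠ b') (hbb' : b ≠ b') (hca : c ≠ a) (hcb : c ≠ b) (hcb' : c ≠ b')
    (hreg : j ≤ 2 ∨ A.card ≤ j + 3)
    (hK : 0 ≤ (1 - θ) *
        ((prodBernoulli w).real {ω : BondConfig (Fin n) | (A.filter fun z => ω ∈ openConn c z).card ≤ j} -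
          (prodBernoulli w).real {ω : BondConfig (Fin n) | (A.filter fun z => ω ∈ openConn a z).card ≤ j}) +
      θ * ((prodBernoulli (Function.update w s(b, b') 1)).real
            {ω : BondConfig (Fin n) | (A.filter fun z => ω ∈ openConn c z).card ≤ j} -
          (prodBernoulli (Function.update w s(b, b') 1)).real
            {ω : BondConfig (Fin n) | (A.filter fun z => ω ∈ openConn a z).card ≤ j})) :
    0 ≤ (1 - θ) *
        ((prodBernoulli w).real {ω : BondConfig (Fin n) | (A.filter fun z => ω ∈ openConn c z).card ≤ j} -
          (prodBernoulli w).real {ω : BondConfig (Fin n) | (A.filter fun z => ω ∈ openConn a z).card ≤ j}) +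
      θ * ((prodBernoulli (Function.update (Function.update w s(b, b') 1) s(a, b) 1)).real
            {ω : BondConfig (Fin n) | (A.filter fun z => ω ∈ openConn c z).card ≤ j} -
          (prodBernoulli (Function.update (Function.update w s(b, b') 1) s(a, b) 1)).real
            {ω : BondConfig (Fin n) | (A.filter fun z => ω ∈ openConn a z).card ≤ j}) := by
  have h := glue_margin_mono w A a b b' c j hb hb' hc hab hab' hbb' hca hcb hcb' hreg
  nlinarith [h, hθ0, hK]

namespace TwoPortPeeling

/-- **Pointwise drop inclusion, connected-pair form.**  As `drop_subset`, with the open pair `s(b,b')` replaced by the weaker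
hypothesis that `b` and `b'` are joined in `ω` (e.g. through a glued Steiner vertex). [this file] -/
theorem drop_subset_of_reachable (A : Finset (Fin n)) (ω : BondConfig (Fin n)) (a b b' c : Fin n) (j : ℕ)
    (hb : b ∈ A) (hb' : b' ∈ A) (hc : c ∈ A)
    (hab : a ≠ b) (hbb' : b ≠ b') (hcb : c ≠ b) (hcb' : c ≠ b')
    (hreg : j ≤ 2 ∨ A.card ≤ j + 3) (hbb : (openGraph ω).Reachable b b')
    (hc_small : (A.filter fun z => ω ∈ openConn c z).card ≤ j)
    (hc_big : ¬ (A.filter fun z => insert s(a, b) ω ∈ openConn c z).card ≤ j) :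
    (A.filter fun z => ω ∈ openConn a z).card ≤ j ∧
      ¬ (A.filter fun z => insert s(a, b) ω ∈ openConn a z).card ≤ j := by
  by_cases hca' : (openGraph ω).Reachable c a
  · refine ⟨?_, ?_⟩
    · rw [← filter_eq_of_reachable A ω hca']; exact hc_small
    · rw [← filter_eq_of_reachable A (insert s(a, b) ω) (reachable_insert_of_reachable ω _ hca')]; exact hc_big
  by_cases hcb'' : (openGraph ω).Reachable c b
  · have h3 : 3 ≤ (A.filter fun z => ω ∈ openConn c z).card := by
      have hsub : ({c, b, b'} : Finset (Fin n)) ⊆ A.filter fun z => ω ∈ openConn c z := by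
        intro z hz
        simp only [Finset.mem_insert, Finset.mem_singleton] at hz
        rw [Finset.mem_filter]
        rcases hz with rfl | rfl | rfl
        · exact ⟨hc, (SimpleGraph.Reachable.refl _ : (openGraph ω).Reachable _ _)⟩
        · exact ⟨hb, hcb''⟩
        · exact ⟨hb', hcb''.trans hbb⟩
      have hcard : ({c, b, b'} : Finset (Fin n)).card = 3 := by
        rw [Finset.card_eq_three]
        exact ⟨c, b, b', hcb, hcb', hbb', rfl⟩
      exact hcard ▸ Finset.card_le_card hsub
    rcases hreg with hj | hk
    · exact absurd (h3.trans hc_small) (by omega)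
    · have hdisj : Disjoint (A.filter fun z => ω ∈ openConn a z) (A.filter fun z => ω ∈ openConn c z) := by
        rw [Finset.disjoint_left]
        intro z hza hzc
        rw [Finset.mem_filter] at hza hzc
        exact hca' ((hzc.2 : (openGraph ω).Reachable c z).trans (hza.2 : (openGraph ω).Reachable a z).symm)
      have hsum : (A.filter fun z => ω ∈ openConn a z).card + (A.filter fun z => ω ∈ openConn c z).card ≤ A.card := by
        rw [← Finset.card_union_of_disjoint hdisj]
        exact Finset.card_le_card (Finset.union_subset (Finset.filter_subset _ _) (Finset.filter_subset _ _))
      refine ⟨by omega, ?_⟩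
      have hac' : (openGraph (insert s(a, b) ω)).Reachable a c := by
        have hab' : (openGraph (insert s(a, b) ω)).Reachable a b := by
          refine SimpleGraph.Adj.reachable ?_
          rw [openGraph_adj]
          exact ⟨Set.mem_insert _ _, hab⟩
        exact hab'.trans (reachable_insert_of_reachable ω _ hcb''.symm)
      rw [filter_eq_of_reachable A (insert s(a, b) ω) hac']
      exact hc_big
  · exfalso
    apply hc_big
    have heq : (A.filter fun z => insert s(a, b) ω ∈ openConn c z) = (A.filter fun z => ω ∈ openConn c z) :=
      Finset.filter_congr fun z _ => ChampionStability.reachable_insert_iff_of_not ω hab hca' hcb'' z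
    rw [heq]
    exact hc_small

/-- **Margin monotonicity, almost-surely-glued form.**  Let `w₁` be any weights under which, with the pair `s(a,b)` closed, the relays
`b ≠ b'` are joined almost surely (e.g. `b, b'` both glued to a Steiner vertex).  Then raising `s(a,b)` to `1` does not decrease `c`'s margin
over `a`:  `μ_{w₁}(R_c) − μ_{w₁}(R_a) ≤ μ_{w₁[s(a,b)↦1]}(R_c) − μ_{w₁[s(a,b)↦1]}(R_a)`  (`j ≤ 2 ∨ |A| ≤ j+3`).  Same proof as
`glue_margin_mono` with `drop_subset_of_reachable`. [this file] -/
theorem glue_margin_mono_of_ae_reachable (w₁ : Sym2 (Fin n) → unitInterval) (A : Finset (Fin n)) (a b b' c : Fin n) (j : ℕ)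
    (hb : b ∈ A) (hb' : b' ∈ A) (hc : c ∈ A)
    (hab : a ≠ b) (hbb' : b ≠ b') (hcb : c ≠ b) (hcb' : c ≠ b')
    (hreg : j ≤ 2 ∨ A.card ≤ j + 3)
    (hnull : (prodBernoulli (Function.update w₁ s(a, b) 0)).real
        {ω : BondConfig (Fin n) | ω ∉ openConn b b'} = 0) :
    (prodBernoulli w₁).real {ω : BondConfig (Fin n) | (A.filter fun z => ω ∈ openConn c z).card ≤ j} -
        (prodBernoulli w₁).real {ω : BondConfig (Fin n) | (A.filter fun z => ω ∈ openConn a z).card ≤ j} ≤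
      (prodBernoulli (Function.update w₁ s(a, b) 1)).real
          {ω : BondConfig (Fin n) | (A.filter fun z => ω ∈ openConn c z).card ≤ j} -
        (prodBernoulli (Function.update w₁ s(a, b) 1)).real
          {ω : BondConfig (Fin n) | (A.filter fun z => ω ∈ openConn a z).card ≤ j} := by
  set w10 := Function.update w₁ s(a, b) 0 with hw10
  set R : Fin n → Set (BondConfig (Fin n)) := fun x => {ω | (A.filter fun z => ω ∈ openConn x z).card ≤ j} with hR
  set ins : BondConfig (Fin n) → BondConfig (Fin n) := fun ω => insert s(a, b) ω with hins
  have hmeas : ∀ S : Set (BondConfig (Fin n)), MeasurableSet S := fun _ => MeasurableSet.of_discrete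
  have h11 : Function.update w₁ s(a, b) 1 = Function.update w10 s(a, b) 1 := by rw [hw10, Function.update_idem]
  have h10e : w10 s(a, b) = 0 := by rw [hw10, Function.update_self]
  have hpull : ∀ S : Set (BondConfig (Fin n)),
      (prodBernoulli (Function.update w₁ s(a, b) 1)).real S = (prodBernoulli w10).real (ins ⁻¹' S) := by
    intro S; rw [h11]; exact ChampionStability.real_update_one_eq w10 h10e S
  have hmix : ∀ S : Set (BondConfig (Fin n)), (prodBernoulli w₁).real S =
      (1 - (w₁ s(a, b) : ℝ)) * (prodBernoulli w10).real S + (w₁ s(a, b) : ℝ) * (prodBernoulli w10).real (ins ⁻¹' S) := by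
    intro S; rw [stub_oneBondDecomp_k15 n w₁ s(a, b) S, ← hw10, hpull S]
  have hsub : ∀ x : Fin n, ins ⁻¹' R x ⊆ R x := fun x ω hω => lonely_of_lonely_insert A ω s(a, b) x j hω
  have hdiff : ∀ x : Fin n, (prodBernoulli w10).real (R x) - (prodBernoulli w10).real (ins ⁻¹' R x) =
      (prodBernoulli w10).real (R x \ ins ⁻¹' R x) := fun x =>
    (measureReal_sdiff (hsub x) (hmeas _)).symm
  set Z : Set (BondConfig (Fin n)) := {ω | ω ∉ openConn b b'} with hZ
  have hincl : R c \ ins ⁻¹' R c ⊆ (R a \ ins ⁻¹' R a) ∪ Z := by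
    intro ω hω
    by_cases hωZ : ω ∈ Z
    · exact Or.inr hωZ
    · have hbb : (openGraph ω).Reachable b b' := by
        by_contra h; exact hωZ h
      obtain ⟨h1, h2⟩ := drop_subset_of_reachable A ω a b b' c j hb hb' hc hab hbb' hcb hcb' hreg hbb hω.1 hω.2
      exact Or.inl ⟨h1, h2⟩
  have hkey : (prodBernoulli w10).real (R c \ ins ⁻¹' R c) ≤ (prodBernoulli w10).real (R a \ ins ⁻¹' R a) := by
    refine (measureReal_mono hincl).trans ((measureReal_union_le _ _).trans ?_)
    rw [hnull, add_zero]
  have hp0 : 0 ≤ 1 - (w₁ s(a, b) : ℝ) := sub_nonneg.2 (w₁ s(a, b)).2.2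
  rw [hmix (R c), hmix (R a), hpull (R c), hpull (R a)]
  rw [← hdiff c, ← hdiff a] at hkey
  nlinarith [hkey, hp0]

end TwoPortPeeling

open TwoPortPeeling in
/-- **E_rel, two-realisation form.**  If `(1−θ)·X + θ·(μ_{w₁}(R_c) − μ_{w₁}(R_a)) ≥ 0` for some real `X` (in the application: `X = μ_w(R_c) − μ_w(R_a)`
and `w₁` ANY weights realising the glued pair `b ≡ b'`, e.g. a two-port star glued to both), `θ ≥ 0`, and `b ↔ b'` almost surely under
`w₁[s(a,b)↦0]`, then `(1−θ)·X + θ·(μ_{w₁[s(a,b)↦1]}(R_c) − μ_{w₁[s(a,b)↦1]}(R_a)) ≥ 0` (`j ≤ 2 ∨ |A| ≤ j+3`).  This is the form in which the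
memo's MS-STAR₂₂ assembly consumes E_rel. [this file; `glue_margin_mono_of_ae_reachable`] -/
theorem thetaChampion_virtualRelay_of_ae_reachable (w₁ : Sym2 (Fin n) → unitInterval) (A : Finset (Fin n)) (a b b' c : Fin n)
    (j : ℕ) (θ X : ℝ) (hθ0 : 0 ≤ θ)
    (hb : b ∈ A) (hb' : b' ∈ A) (hc : c ∈ A)
    (hab : a ≠ b) (hbb' : b ≠ b') (hcb : c ≠ b) (hcb' : c ≠ b')
    (hreg : j ≤ 2 ∨ A.card ≤ j + 3)
    (hnull : (prodBernoulli (Function.update w₁ s(a, b) 0)).real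
        {ω : BondConfig (Fin n) | ω ∉ openConn b b'} = 0)
    (hK : 0 ≤ (1 - θ) * X +
      θ * ((prodBernoulli w₁).real {ω : BondConfig (Fin n) | (A.filter fun z => ω ∈ openConn c z).card ≤ j} -
          (prodBernoulli w₁).real {ω : BondConfig (Fin n) | (A.filter fun z => ω ∈ openConn a z).card ≤ j})) :
    0 ≤ (1 - θ) * X +
      θ * ((prodBernoulli (Function.update w₁ s(a, b) 1)).real
            {ω : BondConfig (Fin n) | (A.filter fun z => ω ∈ openConn c z).card ≤ j} -
          (prodBernoulli (Function.update w₁ s(a, b) 1)).real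
            {ω : BondConfig (Fin n) | (A.filter fun z => ω ∈ openConn a z).card ≤ j}) := by
  have h := glue_margin_mono_of_ae_reachable w₁ A a b b' c j hb hb' hc hab hbb' hcb hcb' hreg hnull
  nlinarith [h, hθ0, hK]

end Summit.CriticalPhenomena.PercolationContinuityZ3.Theorems

end
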